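import Mathlib

/-!
# The sources of the hierarchy of `Γ` in the COMPLEX domain: holomorphy and the real trace
# (crux `DenseExcursion`, stmt-AtomisticToContinuum-12586, line `sonic-cavity-renewal` v9, stub `stub_analyticPackingImplosion`)

Helper file (`--supports stmt-AtomisticToContinuum-12586`, line lead a2, wave-5 worker D2, task `packingSources_holomorphic`
(qualitative half), worker report `work/stubs/D2_triangle.REPORT.md` §4 (R1)). The complexified order-`k` sources of
`packingHierarchy_order` (holomorphic coefficients `wc i, sc i : ℂ → ℂ`, complex derivatives, `Complex.exp (3z)`, stiffening
coefficients in the closed form of `familyCoeff_stiffening` with the real jet `m`):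

* `differentiableOn_coeff_mk_pow`: `z ↦ [Gᵈ](Σₙ sc n z Gⁿ)ᴺ` is holomorphic where `sc 0, …, sc d` are (induction on `N` via
  `coeff_mul`: the coefficient is a finite polynomial in `sc 0 z, …, sc d z`);
* `packingSources_holomorphicOn` (REGISTERED helper): on an open set where `wc i, sc i` (`i ≤ k`) are holomorphic, both complex
  sources are holomorphic;
* `coeff_mk_pow_ofReal`, `packingSources_ofReal`: at a real point where `wc i, sc i` and their complex derivatives are the real
  values `wr i, sr i, (wr i)′, (sr i)′`, the complex sources ARE the real sources of `packingHierarchy_order` (cast to `ℂ`) — the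
  "real on the real window" input of `sonicWindow_analytic_bound`.

Pure algebra/calculus over Mathlib. NOT here: any bound (see `packingSources_holomorphic_bound`) or `Γ`.
-/

noncomputable section

open Finset PowerSeries

namespace Summit.AtomisticToContinuum.HydrodynamicLimit.Theorems.PackingAnalyticImplosion

/-! ## Holomorphy of power-series coefficients of powers -/

/-- `z ↦ [Gᵈ](Σₙ sc n z Gⁿ)ᴺ` is holomorphic on `D` as soon as `sc 0, …, sc d` are. [folklore] -/
theorem differentiableOn_coeff_mk_pow {D : Set ℂ} {sc : ℕ → ℂ → ℂ} {d : ℕ}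
    (h : ∀ n, n ≤ d → DifferentiableOn ℂ (sc n) D) :
    ∀ N : ℕ, DifferentiableOn ℂ (fun z => coeff d ((PowerSeries.mk fun n => sc n z) ^ N)) D := by
  intro N
  induction N generalizing d with
  | zero =>
    simp only [pow_zero, coeff_one]
    exact differentiableOn_const _
  | succ N ih =>
    have e : (fun z => coeff d ((PowerSeries.mk fun n => sc n z) ^ (N + 1))) = fun z =>
        ∑ i ∈ range (d + 1), coeff i ((PowerSeries.mk fun n => sc n z) ^ N) * sc (d - i) z := by
      funext z
      rw [pow_succ, coeff_mul, Nat.sum_antidiagonal_eq_sum_range_succ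
        (fun i j => coeff i ((PowerSeries.mk fun n => sc n z) ^ N) * coeff j (PowerSeries.mk fun n => sc n z)) d]
      simp only [coeff_mk]
    rw [e]
    refine DifferentiableOn.fun_sum fun i hi => ?_
    have hid : i ≤ d := Nat.lt_succ_iff.mp (mem_range.mp hi)
    exact (ih (d := i) fun n hn => h n (hn.trans hid)).fun_mul (h (d - i) (Nat.sub_le d i))

/-- **HOLOMORPHY OF THE COMPLEX SOURCES** (registered helper `packingSources_holomorphicOn` of
`stub_analyticPackingImplosion`): on an open set on which `wc i, sc i`, `i ≤ k`, are holomorphic, the complexified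
order-`k` sources of `packingHierarchy_order` are holomorphic. [folklore] -/
theorem packingSources_holomorphicOn : ∀ (D : Set ℂ) (wc sc : ℕ → ℂ → ℂ) (m : ℕ → ℝ) (k : ℕ), IsOpen D → (∀ i, i ≤ k → DifferentiableOn ℂ (wc i) D ∧ DifferentiableOn ℂ (sc i) D) → DifferentiableOn ℂ (fun z => (∑ i ∈ Finset.Ico 1 k, (wc i z * deriv (wc (k - i)) z + wc i z * wc (k - i) z + 3 * (sc i z * (deriv (sc (k - i)) z + sc (k - i) z)))) + 3 * ∑ p ∈ Finset.range k, (∑ i ∈ Finset.range (p + 1), sc i z * (deriv (sc (p - i)) z + sc (p - i) z)) * ∑ j ∈ Finset.range (k - p + 1), (m j : ℂ) * Complex.exp (3 * z) ^ j * PowerSeries.coeff (k - p - j) ((PowerSeries.mk fun n => sc n z) ^ (3 * j))) D ∧ DifferentiableOn ℂ (fun z => ∑ i ∈ Finset.Ico 1 k, (wc i z * deriv (sc (k - i)) z + sc i z / 3 * deriv (wc (k - i)) z + 2 * (sc i z * wc (k - i) z))) D := by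
  intro D wc sc m k hD h
  have hw : ∀ i, i ≤ k → DifferentiableOn ℂ (wc i) D := fun i hi => (h i hi).1
  have hs : ∀ i, i ≤ k → DifferentiableOn ℂ (sc i) D := fun i hi => (h i hi).2
  have hw' : ∀ i, i ≤ k → DifferentiableOn ℂ (deriv (wc i)) D := fun i hi =>
    (((hw i hi).analyticOnNhd hD).deriv).differentiableOn
  have hs' : ∀ i, i ≤ k → DifferentiableOn ℂ (deriv (sc i)) D := fun i hi =>
    (((hs i hi).analyticOnNhd hD).deriv).differentiableOn
  have hexp : DifferentiableOn ℂ (fun z => Complex.exp (3 * z)) D := by fun_prop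
  constructor
  · refine DifferentiableOn.fun_add (DifferentiableOn.fun_sum fun i hi => ?_) (DifferentiableOn.const_mul ?_ _)
    · obtain ⟨hi1, hik⟩ := mem_Ico.mp hi
      have hki : k - i ≤ k := Nat.sub_le k i
      exact (((hw i hik.le).fun_mul (hw' _ hki)).fun_add ((hw i hik.le).fun_mul (hw _ hki))).fun_add
        (((hs i hik.le).fun_mul ((hs' _ hki).fun_add (hs _ hki))).const_mul _)
    · refine DifferentiableOn.fun_sum fun p hp => ?_
      have hpk : p < k := mem_range.mp hp
      refine DifferentiableOn.fun_mul (DifferentiableOn.fun_sum fun i hi => ?_) (DifferentiableOn.fun_sum fun j hj => ?_)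
      · have hip : i ≤ p := Nat.lt_succ_iff.mp (mem_range.mp hi)
        have h1 : i ≤ k := by omega
        have h2 : p - i ≤ k := by omega
        exact (hs i h1).fun_mul ((hs' _ h2).fun_add (hs _ h2))
      · refine DifferentiableOn.fun_mul (DifferentiableOn.fun_mul (differentiableOn_const _) (hexp.pow _)) ?_
        exact differentiableOn_coeff_mk_pow (fun n hn => hs n (by omega)) _
  · refine DifferentiableOn.fun_sum fun i hi => ?_
    obtain ⟨hi1, hik⟩ := mem_Ico.mp hi
    have hki : k - i ≤ k := Nat.sub_le k i
    exact (((hw i hik.le).fun_mul (hs' _ hki)).fun_add (((hs i hik.le).div_const _).fun_mul (hw' _ hki))).fun_add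
      (((hs i hik.le).fun_mul (hw _ hki)).const_mul _)

/-! ## The real trace -/

/-- At a real point where the complex coefficients take the real values, the power-series coefficient is real:
`[Gᵈ](Σ sc n x Gⁿ)ᴺ = ↑([Gᵈ](Σ sr n x Gⁿ)ᴺ)`. [folklore] -/
theorem coeff_mk_pow_ofReal {sc : ℕ → ℂ → ℂ} {sr : ℕ → ℝ → ℝ} {x : ℝ} (h : ∀ n, sc n (x : ℂ) = ((sr n x : ℝ) : ℂ))
    (d N : ℕ) : coeff d ((PowerSeries.mk fun n => sc n (x : ℂ)) ^ N) = ((coeff d ((PowerSeries.mk fun n => sr n x) ^ N) : ℝ) : ℂ) := by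
  have e : (PowerSeries.mk fun n => sc n (x : ℂ)) = PowerSeries.map Complex.ofRealHom (PowerSeries.mk fun n => sr n x) := by
    ext n; simp [coeff_mk, h n]
  rw [e, ← map_pow, coeff_map]
  rfl

/-- **THE COMPLEX SOURCES ON THE REAL TRACE**: if at the real point `x` the complex coefficients and their complex
derivatives are the real values and derivatives, then both complexified sources equal the real sources of
`packingHierarchy_order`, cast to `ℂ`. [folklore] -/
theorem packingSources_ofReal (wc sc : ℕ → ℂ → ℂ) (wr sr : ℕ → ℝ → ℝ) (m : ℕ → ℝ) (k : ℕ) (x : ℝ)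
    (h : ∀ i, wc i (x : ℂ) = ((wr i x : ℝ) : ℂ) ∧ sc i (x : ℂ) = ((sr i x : ℝ) : ℂ) ∧
      deriv (wc i) (x : ℂ) = ((deriv (wr i) x : ℝ) : ℂ) ∧ deriv (sc i) (x : ℂ) = ((deriv (sr i) x : ℝ) : ℂ)) :
    ((∑ i ∈ Finset.Ico 1 k, (wc i x * deriv (wc (k - i)) x + wc i x * wc (k - i) x +
        3 * (sc i x * (deriv (sc (k - i)) x + sc (k - i) x)))) +
      3 * ∑ p ∈ Finset.range k, (∑ i ∈ Finset.range (p + 1), sc i x * (deriv (sc (p - i)) x + sc (p - i) x)) *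
        ∑ j ∈ Finset.range (k - p + 1), (m j : ℂ) * Complex.exp (3 * x) ^ j *
          PowerSeries.coeff (k - p - j) ((PowerSeries.mk fun n => sc n x) ^ (3 * j)) =
      (((∑ i ∈ Finset.Ico 1 k, (wr i x * deriv (wr (k - i)) x + wr i x * wr (k - i) x +
        3 * (sr i x * (deriv (sr (k - i)) x + sr (k - i) x)))) +
      3 * ∑ p ∈ Finset.range k, (∑ i ∈ Finset.range (p + 1), sr i x * (deriv (sr (p - i)) x + sr (p - i) x)) *
        ∑ j ∈ Finset.range (k - p + 1), m j * Real.exp (3 * x) ^ j *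
          PowerSeries.coeff (k - p - j) ((PowerSeries.mk fun n => sr n x) ^ (3 * j)) : ℝ) : ℂ)) ∧
    ((∑ i ∈ Finset.Ico 1 k, (wc i x * deriv (sc (k - i)) x + sc i x / 3 * deriv (wc (k - i)) x +
        2 * (sc i x * wc (k - i) x))) =
      ((∑ i ∈ Finset.Ico 1 k, (wr i x * deriv (sr (k - i)) x + sr i x / 3 * deriv (wr (k - i)) x +
        2 * (sr i x * wr (k - i) x)) : ℝ) : ℂ)) := by
  have hw : ∀ i, wc i (x : ℂ) = ((wr i x : ℝ) : ℂ) := fun i => (h i).1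
  have hs : ∀ i, sc i (x : ℂ) = ((sr i x : ℝ) : ℂ) := fun i => (h i).2.1
  have hw' : ∀ i, deriv (wc i) (x : ℂ) = ((deriv (wr i) x : ℝ) : ℂ) := fun i => (h i).2.2.1
  have hs' : ∀ i, deriv (sc i) (x : ℂ) = ((deriv (sr i) x : ℝ) : ℂ) := fun i => (h i).2.2.2
  have hc' : ∀ d N, coeff d ((PowerSeries.mk fun n => ((sr n x : ℝ) : ℂ)) ^ N) =
      ((coeff d ((PowerSeries.mk fun n => sr n x) ^ N) : ℝ) : ℂ) := fun d N =>
    coeff_mk_pow_ofReal (sc := fun n _ => ((sr n x : ℝ) : ℂ)) (sr := sr) (x := x) (fun n => rfl) d N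
  have he : Complex.exp (3 * (x : ℂ)) = ((Real.exp (3 * x) : ℝ) : ℂ) := by
    rw [Complex.ofReal_exp]; push_cast; ring_nf
  constructor
  · simp only [hw, hs, hw', hs', he]
    push_cast
    simp only [hc']
  · simp only [hw, hs, hw', hs']
    push_cast
    rfl

end Summit.AtomisticToContinuum.HydrodynamicLimit.Theorems.PackingAnalyticImplosion

end
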